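import Summits.ResolutionOfSingularities.ResolutionOfSingularities.Theorems.FrobeniusLadderFInjectiveMacaulayficationFHalfRowOfProductCentre
import HarnessLib

/-!
# Germ transport: a global blow-up model FULL over the generizations of `x` ⇒ EVERY blowing up of `Spec 𝒪_{X,x}` along the pulled-back centre is FULL at every stalk
# (crux `FInjectiveMacaulayfication` stmt-ResolutionOfSingularities-15315, chain w45a; seat res-L1-w45a-stub-1 g12; generic form of ✓ p662224 `TCaFloorOneRow.pointFloor_tca_full` and of
# bullet 3 of ✓ `FHalfRowOfProductCentre.fHalfConclusion_of_isBlowup_mul`; needed by the (W-TD) D-3 assembly (storey 2 at the point `P`: model = the class row's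
# `affineBlowup (𝔪_P·K′)` over `k[Y]/(G)`, ✓ p656605) and by every future «floor already FULL» row)

[OURS · L1 W4.5a] Support file (`--supports stmt-ResolutionOfSingularities-15315 --as helper`); def-free; UNCONDITIONAL; no named fact. AI-written (AI review weaker than expert review).

* ★ `forall_isBlowup_germ_fullCl_of_model` — `π₀ : X' → X` a blowing up along `J`, FULL at every point of `X'` lying over a generization of `x`; then every blowing up
  `g : S′ → Spec 𝒪_{X,x}` along `J·𝒪_{X,x}` (`J.comap (X.fromSpecStalk x)`) is FULL at EVERY stalk (flat base change `IsBlowup.pullback_snd_of_flat`, uniqueness `IsBlowup.unique`,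
  stalk isomorphisms `isIso_stalkMap_pullback_fst_fromSpecStalk`).
* `forall_isBlowup_germ_fullCl_of_affineBlowup` — affine form: `A` a ring, `I` an ideal, `affineBlowup I` FULL at every point ⇒ the same for every blowing up of `Spec 𝒪_{Spec A,x}`
  along `I·𝒪`.
[cite: GortzWedhorn2020, Prop. 13.91; (13.19)] [cite: StacksProject, Tag 0804 and Tag 085S]
-/

-- single-problem summit: the doubled namespace component is forced
set_option linter.dupNamespace false

noncomputable section

namespace Summit.ResolutionOfSingularities.ResolutionOfSingularities.Theorems.FInjectiveMacaulayfication.GermFullOfModel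

open CategoryTheory CategoryTheory.Limits AlgebraicGeometry TopologicalSpace IsLocalRing
open Literature.AlgebraicGeometry.Resolution
open Summit.ResolutionOfSingularities.ResolutionOfSingularities.Theorems.FInjectiveMacaulayfication
open SliceableCentre GermOfGlobalBlowup

/-- ★ **Germ transport of FULL-ness from a global blow-up model.** See the module docstring. [folklore transport; cite: GortzWedhorn2020, Prop. 13.91] -/
theorem forall_isBlowup_germ_fullCl_of_model (p : ℕ) {X X' : Scheme.{0}} (x : X) {π₀ : X' ⟶ X} {J : X.IdealSheafData} (hπ₀ : IsBlowup π₀ J)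
    (hfull : ∀ x' : X', π₀.base x' ⤳ x → FullCl p (X'.presheaf.stalk x')) :
    ∀ (S' : Scheme.{0}) (g : S' ⟶ Spec (X.presheaf.stalk x)), IsBlowup g (J.comap (X.fromSpecStalk x)) →
      ∀ s : S', FullCl p (S'.presheaf.stalk s) := by
  intro S' g hg s
  haveI : Flat (X.fromSpecStalk x) := flat_fromSpecStalk X x
  have hP : IsBlowup (pullback.snd π₀ (X.fromSpecStalk x)) (J.comap (X.fromSpecStalk x)) := hπ₀.pullback_snd_of_flat (X.fromSpecStalk x)
  obtain ⟨e, -, -⟩ := hg.unique hP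
  haveI := isIso_stalkMap_of_flat_of_isPreimmersion e.hom s
  refine FTemkinClosedPoints.fullCl_of_isIso_stalkMap' p e.hom s ?_
  haveI := isIso_stalkMap_pullback_fst_fromSpecStalk π₀ x (e.hom s)
  refine FTemkinClosedPoints.fullCl_of_isIso_stalkMap' p (pullback.fst π₀ (X.fromSpecStalk x)) (e.hom s) (hfull _ ?_)
  have hmem : (pullback.fst π₀ (X.fromSpecStalk x)) (e.hom s) ∈ Set.range (pullback.fst π₀ (X.fromSpecStalk x)) := ⟨e.hom s, rfl⟩
  rw [range_pullback_fst_fromSpecStalk] at hmem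
  exact hmem

/-- **Affine form**: `affineBlowup I` FULL at every point ⇒ every blowing up of `Spec 𝒪_{Spec A, x}` along `I·𝒪` is FULL at every stalk. [folklore transport] -/
theorem forall_isBlowup_germ_fullCl_of_affineBlowup (p : ℕ) {A : Type} [CommRing A] (I : Ideal A) (x : Spec (.of A))
    (hfull : ∀ y : ↥(affineBlowup I), FullCl p ((affineBlowup I).presheaf.stalk y)) :
    ∀ (S' : Scheme.{0}) (g : S' ⟶ Spec ((Spec (.of A)).presheaf.stalk x)),
      IsBlowup g ((affineBlowup.idealSheaf I).comap ((Spec (.of A)).fromSpecStalk x)) → ∀ s : S', FullCl p (S'.presheaf.stalk s) :=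
  forall_isBlowup_germ_fullCl_of_model p x (affineBlowup.isBlowup I) (fun y _ => hfull y)

end Summit.ResolutionOfSingularities.ResolutionOfSingularities.Theorems.FInjectiveMacaulayfication.GermFullOfModel

end
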